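import Mathlib
import Literature.Computability.AlgebraicComplexity.DeterminantalConormalBoundMixed

/-!
# Crux `DetQP.DetqpSuperquadratic` (stmt-ValiantsHypothesis-0318), line `sectional-class-ladder`
# (skeleton v2, ND route) — helper for stub `stub_polarCountND`: the kernel-incidence system
# vanishes at lifted polar points; the homogenised pencil is non-zero; the mixed Bézout number

Stub `stub_polarCountND` re-runs the tree's `ncard_polarSet_le_conormalBezout_of_pencil`
(`Literature/Computability/AlgebraicComplexity/DeterminantalConormalBoundMixed.lean`,
arXiv:2606.13628 §3.1) for finite sets of NON-DEGENERATE polar points. This file isolates three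
point-independent steps of that proof, with Sheshadri's system
`Q = (chart, Â(x)v, (uᵀÂ(x))Λ, pencil)` on `τ = (x₀ ⊔ σ) ⊔ (u ⊔ v)` passed as data
`(phat, Ahat, wp, Q)` plus defining equations (the `set … with` equations of the assembly):
* `kernelSystem_eval_lift_eq_zero` — the lift `z = (1 : x, u, v)` of a polar point `x` with
  kernel pair `(u, v)` (`uᵀA(x) = 0`, `A(x)v = 0`, `∂ᵢ det A(x) = uᵀAᵢv ∈ ℂa + ℂb`, `c·x = 1`)
  solves every equation;
* `homogenisedPencil_ne_zero` — `Â ≠ 0` when `det A ≠ 0`; `exists_coeff_single_ne_zero` — a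
  non-constant `det A` has an entry with a non-zero linear coefficient;
* `coeff_kernelSystemDegrees_eq_conormalBezout` — the mixed Bézout number of the multidegrees
  `e₀; (e₀+e₁)^{m}; (e₀+e₂)^{m-1}; (e₁+e₂)^{N-2}` on `ℙ^N × ℙ^{m-1} × ℙ^{m-1}` is `B(m, N)`
  (`coeff_generatingFunction_eq_conormalBezout`).
The proofs are the corresponding steps of the tree proof, verbatim up to the packaging.
References: K. Sheshadri, arXiv:2606.13628 (2026), §3.1 [Sheshadri2026Border]; W. Fulton,
*Intersection Theory*, 2nd ed., 1998, Example 12.3.1 [Fulton1998].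
-/

noncomputable section

-- `Summit.ValiantsHypothesis.ValiantsHypothesis.…` is the tree's mandated single-conjunct layout
-- (Sub = Summit), so the duplicated namespace component is intended.
set_option linter.dupNamespace false

namespace Summit.ValiantsHypothesis.ValiantsHypothesis.Theorems.DetQPDetqpSuperquadratic

open MvPolynomial Matrix Finset
open Literature.Computability.AlgebraicComplexity
open Literature.Computability.AlgebraicComplexity.DeterminantalConormal
open Literature.RingTheory.MvPolynomial

/-- **Lifted polar points solve the kernel-incidence system** (arXiv:2606.13628 §3.1 Steps 2–4):
if `uᵀ A(x) = 0`, `A(x) v = 0`, `∂ᵢ(det A)(x) = uᵀ Aᵢ v` lies on the pencil `ℂa + ℂb` and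
`c · x = 1`, then `z = (1 : x, u, v)` is a zero of the chart, right-kernel, reduced left-kernel
and pencil equations. [cite: Sheshadri2026Border, §3.1 Steps 2–4] -/
theorem kernelSystem_eval_lift_eq_zero {σ : Type} [Fintype σ] [DecidableEq σ] {m : ℕ}
    (A : Matrix (Fin (m + 1)) (Fin (m + 1)) (MvPolynomial σ ℂ))
    (hA1 : ∀ k l, (A k l).totalDegree ≤ 1) (a b c : σ → ℂ) {j₀ k₀ : σ}
    (hδ : a j₀ * b k₀ - a k₀ * b j₀ ≠ 0) (Λ : Matrix (Fin (m + 1)) (Fin m) ℂ)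
    (x0 : ((Unit ⊕ σ) ⊕ (Fin (m + 1) ⊕ Fin (m + 1))))
    (xv : σ → ((Unit ⊕ σ) ⊕ (Fin (m + 1) ⊕ Fin (m + 1))))
    (uu vv : Fin (m + 1) → ((Unit ⊕ σ) ⊕ (Fin (m + 1) ⊕ Fin (m + 1))))
    (hx0 : x0 = Sum.inl (Sum.inl ())) (hxv : xv = fun i => Sum.inl (Sum.inr i))
    (huu : uu = fun k => Sum.inr (Sum.inl k)) (hvv : vv = fun l => Sum.inr (Sum.inr l))
    (phat : MvPolynomial σ ℂ → MvPolynomial ((Unit ⊕ σ) ⊕ (Fin (m + 1) ⊕ Fin (m + 1))) ℂ)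
    (hphat : phat = fun p =>
      C (coeff 0 p) * X x0 + ∑ i, C (coeff (Finsupp.single i 1) p) * X (xv i))
    (Ahat : Matrix (Fin (m + 1)) (Fin (m + 1))
      (MvPolynomial ((Unit ⊕ σ) ⊕ (Fin (m + 1) ⊕ Fin (m + 1))) ℂ))
    (hAhat : Ahat = A.map phat)
    (wp : σ → MvPolynomial ((Unit ⊕ σ) ⊕ (Fin (m + 1) ⊕ Fin (m + 1))) ℂ)
    (hwp : wp = fun i =>
      ∑ k, ∑ l, C (coeff (Finsupp.single i 1) (A k l)) * X (uu k) * X (vv l))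
    (Q : ((Unit ⊕ Fin (m + 1)) ⊕ (Fin m ⊕ {i : σ // i ≠ j₀ ∧ i ≠ k₀})) →
      MvPolynomial ((Unit ⊕ σ) ⊕ (Fin (m + 1) ⊕ Fin (m + 1))) ℂ)
    (hQ : Q = Sum.elim
      (Sum.elim (fun _ => X x0 - ∑ i, C (c i) * X (xv i)) (fun k => ∑ l, Ahat k l * X (vv l)))
      (Sum.elim
        (fun j => ∑ k, X (uu k) * (Ahat * Λ.map (fun r : ℂ =>
          (C r : MvPolynomial ((Unit ⊕ σ) ⊕ (Fin (m + 1) ⊕ Fin (m + 1))) ℂ))) k j)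
        (fun i => C (a j₀ * b k₀ - a k₀ * b j₀) * wp i.1 -
          (C (b k₀) * wp j₀ - C (b j₀) * wp k₀) * C (a i.1) -
          (C (a j₀) * wp k₀ - C (a k₀) * wp j₀) * C (b i.1))))
    (x : σ → ℂ) (u v : Fin (m + 1) → ℂ) (huM : u ᵥ* A.map (eval x) = 0)
    (hMv : A.map (eval x) *ᵥ v = 0)
    (hpd : ∀ i, eval x (pderiv i A.det) =
      u ⬝ᵥ (A.map (fun p => coeff (Finsupp.single i 1) p) *ᵥ v))
    (hspan : ∃ s t : ℂ, ∀ i, eval x (pderiv i A.det) = s * a i + t * b i)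
    (hcx : ∑ i, c i * x i = 1)
    (z : ((Unit ⊕ σ) ⊕ (Fin (m + 1) ⊕ Fin (m + 1))) → ℂ)
    (hz : z = Sum.elim (Sum.elim (fun _ => 1) x) (Sum.elim u v)) :
    ∀ j, eval z (Q j) = 0 := by
  classical
  have hphat_eval : ∀ p (y : ((Unit ⊕ σ) ⊕ (Fin (m + 1) ⊕ Fin (m + 1))) → ℂ),
      eval y (phat p) = y x0 * coeff 0 p + ∑ i, y (xv i) * coeff (Finsupp.single i 1) p := by
    intro p y
    simp only [hphat, map_add, map_sum, map_mul, eval_C, eval_X]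
    rw [mul_comm]
    exact congrArg _ (Finset.sum_congr rfl fun i _ => mul_comm _ _)
  have hzx0 : z x0 = 1 := by simp [hz, hx0]
  have hzxv : ∀ i, z (xv i) = x i := fun i => by simp [hz, hxv]
  have hzuu : ∀ k, z (uu k) = u k := fun k => by simp [hz, huu]
  have hzvv : ∀ l, z (vv l) = v l := fun l => by simp [hz, hvv]
  have hAhat_z : Ahat.map (eval z) = A.map (eval x) := by
    refine Matrix.ext fun k l => ?_
    simp only [hAhat, Matrix.map_apply, hphat_eval, hzx0, hzxv, one_mul]
    rw [eval_eq_coeff_zero_add_sum (hA1 k l)]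
    exact congrArg _ (Finset.sum_congr rfl fun i _ => mul_comm _ _)
  have heval_w : ∀ (y : ((Unit ⊕ σ) ⊕ (Fin (m + 1) ⊕ Fin (m + 1))) → ℂ) i, eval y (wp i) =
      (fun k => y (uu k)) ⬝ᵥ
        (A.map (fun p => coeff (Finsupp.single i 1) p) *ᵥ fun l => y (vv l)) := by
    intro y i
    simp only [hwp, map_sum, map_mul, eval_C, eval_X, dotProduct, mulVec, Matrix.map_apply,
      Finset.mul_sum]
    refine Finset.sum_congr rfl fun k _ => Finset.sum_congr rfl fun l _ => ?_
    ring
  have hw_z : ∀ i, eval z (wp i) = eval x (pderiv i A.det) := by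
    intro i
    rw [heval_w, hpd i]
    simp only [hzuu, hzvv]
  obtain ⟨s, t, hst⟩ := hspan
  intro j
  rcases j with ((_ | k) | (j | i))
  · have heval_chart : eval z (Q (Sum.inl (Sum.inl ()))) = z x0 - ∑ i, c i * z (xv i) := by
      simp [hQ]
    rw [heval_chart, hzx0]
    simp only [hzxv]
    rw [hcx, sub_self]
  · have heval_row : eval z (Q (Sum.inl (Sum.inr k))) =
        (Ahat.map (eval z) *ᵥ fun l => z (vv l)) k := by
      simp [hQ, mulVec, dotProduct]
    rw [heval_row, hAhat_z]
    simp only [hzvv]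
    exact congrFun hMv k
  · have heval_ucut : eval z (Q (Sum.inr (Sum.inl j))) =
        (((fun k => z (uu k)) ᵥ* Ahat.map (eval z)) ᵥ* Λ) j := by
      simp only [hQ, Sum.elim_inr, Sum.elim_inl, map_sum, map_mul, eval_X, Matrix.mul_apply,
        Matrix.map_apply, eval_C, vecMul, dotProduct, Finset.sum_mul]
      rw [Finset.sum_comm]
      refine Finset.sum_congr rfl fun k _ => ?_
      rw [Finset.mul_sum]
      refine Finset.sum_congr rfl fun l _ => ?_
      ring
    rw [heval_ucut, hAhat_z]
    simp only [hzuu]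
    rw [show (fun k => u k) = u from rfl, huM, zero_vecMul]
    rfl
  · have heval_pencil : eval z (Q (Sum.inr (Sum.inr i))) =
        (a j₀ * b k₀ - a k₀ * b j₀) * eval z (wp i.1) -
          (b k₀ * eval z (wp j₀) - b j₀ * eval z (wp k₀)) * a i.1 -
          (a j₀ * eval z (wp k₀) - a k₀ * eval z (wp j₀)) * b i.1 := by
      simp [hQ]
    rw [heval_pencil, hw_z, hw_z, hw_z]
    exact (polarSystem_eq_zero_iff hδ).mpr ⟨s, t, hst⟩ i.1

/-- **The homogenised pencil is non-zero**: if `det A ≠ 0` then some entry of `A` is a non-zero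
affine-linear form, and its homogenisation `p̂ = p₀ x₀ + Σ pᵢ xᵢ` is non-zero.
[cite: Sheshadri2026Border, §3.1 Step 3] -/
theorem homogenisedPencil_ne_zero {σ : Type} [Fintype σ] [DecidableEq σ] {m : ℕ}
    (A : Matrix (Fin (m + 1)) (Fin (m + 1)) (MvPolynomial σ ℂ))
    (hA1 : ∀ k l, (A k l).totalDegree ≤ 1) (hA0 : A.det ≠ 0)
    (x0 : ((Unit ⊕ σ) ⊕ (Fin (m + 1) ⊕ Fin (m + 1))))
    (xv : σ → ((Unit ⊕ σ) ⊕ (Fin (m + 1) ⊕ Fin (m + 1))))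
    (hx0 : x0 = Sum.inl (Sum.inl ())) (hxv : xv = fun i => Sum.inl (Sum.inr i))
    (phat : MvPolynomial σ ℂ → MvPolynomial ((Unit ⊕ σ) ⊕ (Fin (m + 1) ⊕ Fin (m + 1))) ℂ)
    (hphat : phat = fun p =>
      C (coeff 0 p) * X x0 + ∑ i, C (coeff (Finsupp.single i 1) p) * X (xv i))
    (Ahat : Matrix (Fin (m + 1)) (Fin (m + 1))
      (MvPolynomial ((Unit ⊕ σ) ⊕ (Fin (m + 1) ⊕ Fin (m + 1))) ℂ))
    (hAhat : Ahat = A.map phat) :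
    Ahat ≠ 0 := by
  classical
  have hphat_eval : ∀ p (y : ((Unit ⊕ σ) ⊕ (Fin (m + 1) ⊕ Fin (m + 1))) → ℂ),
      eval y (phat p) = y x0 * coeff 0 p + ∑ i, y (xv i) * coeff (Finsupp.single i 1) p := by
    intro p y
    simp only [hphat, map_add, map_sum, map_mul, eval_C, eval_X]
    rw [mul_comm]
    exact congrArg _ (Finset.sum_congr rfl fun i _ => mul_comm _ _)
  have hphat_ne : ∀ p, p.totalDegree ≤ 1 → p ≠ 0 → phat p ≠ 0 := by
    intro p hp hp0 h0
    apply hp0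
    rw [eq_zero_iff_of_totalDegree_le_one hp]
    constructor
    · have h1 := congrArg (eval (fun t => if t = x0 then (1 : ℂ) else 0)) h0
      rw [hphat_eval, map_zero] at h1
      simpa [hxv, hx0] using h1
    · intro i
      have h1 := congrArg (eval (fun t => if t = xv i then (1 : ℂ) else 0)) h0
      rw [hphat_eval, map_zero] at h1
      simp only [hxv, hx0, reduceCtorEq, Sum.inl.injEq, if_false, zero_mul, zero_add,
        Sum.inr.injEq] at h1
      rw [Finset.sum_eq_single i (fun j _ hj => by rw [if_neg hj, zero_mul])
        (fun h => absurd (Finset.mem_univ i) h), if_pos rfl, one_mul] at h1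
      exact h1
  have hrowA : ∃ l, A 0 l ≠ 0 := by
    by_contra h
    push Not at h
    exact hA0 (Matrix.det_eq_zero_of_row_eq_zero 0 h)
  obtain ⟨l, hl⟩ := hrowA
  intro h
  have := congrFun (congrFun h 0) l
  rw [hAhat, Matrix.map_apply, Matrix.zero_apply] at this
  exact hphat_ne _ (hA1 0 l) hl this

/-- If `det A` is not a constant, some entry of the affine matrix `A` has a non-zero linear
coefficient. [folklore] -/
theorem exists_coeff_single_ne_zero {σ : Type} [Fintype σ] {k : ℕ}
    (A : Matrix (Fin k) (Fin k) (MvPolynomial σ ℂ)) (hA1 : ∀ r c, (A r c).totalDegree ≤ 1)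
    (hdeg : A.det.totalDegree ≠ 0) : ∃ j₀ r c, coeff (Finsupp.single j₀ 1) (A r c) ≠ 0 := by
  by_contra h
  push Not at h
  have hconst : ∀ r c, A r c = C (coeff 0 (A r c)) := fun r c => by
    conv_lhs => rw [eq_C_add_sum_of_totalDegree_le_one (hA1 r c)]
    simp [h]
  have hA : A = (A.map (coeff 0)).map (C : ℂ →+* MvPolynomial σ ℂ) := by
    refine Matrix.ext fun r c => ?_
    rw [Matrix.map_apply, Matrix.map_apply]
    exact hconst r c
  have hdetC : A.det = C ((A.map (coeff 0)).det) := by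
    conv_lhs => rw [hA]
    rw [← RingHom.mapMatrix_apply, ← RingHom.map_det]
  exact hdeg (by rw [hdetC, totalDegree_C])

/-- **The mixed Bézout number of the kernel-incidence system is `B(m, N)`**
(arXiv:2606.13628 §3.1 Step 6): for the blocks `x₀, x ↦ 0` (of size `N + 1`), `v ↦ 1`,
`u ↦ 2` (of size `m` each) and the multidegrees `e₀` (chart), `e₀ + e₁` (`m` right kernel
equations), `e₀ + e₂` (`m − 1` reduced left kernel equations), `e₁ + e₂` (`N − 2` pencil
equations), `[T₀^N T₁^{m-1} T₂^{m-1}] T₀ (T₀+T₁)^m (T₀+T₂)^{m-1} (T₁+T₂)^{N-2} = B(m, N)`.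
[cite: Sheshadri2026Border, §3.1 Step 6] -/
theorem coeff_kernelSystemDegrees_eq_conormalBezout {σ : Type} [Fintype σ] [DecidableEq σ] {m : ℕ}
    (hσ : 3 ≤ Fintype.card σ) {j₀ k₀ : σ} (hjk : j₀ ≠ k₀)
    (blk : ((Unit ⊕ σ) ⊕ (Fin (m + 1) ⊕ Fin (m + 1))) → Fin 3)
    (hblk : blk = Sum.elim (fun _ => 0) (Sum.elim (fun _ => 2) (fun _ => 1)))
    (δ : ((Unit ⊕ Fin (m + 1)) ⊕ (Fin m ⊕ {i : σ // i ≠ j₀ ∧ i ≠ k₀})) → Fin 3 → ℕ)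
    (hδdef : δ = Sum.elim
      (Sum.elim (fun _ => Pi.single 0 1) (fun _ => Pi.single 0 1 + Pi.single 1 1))
      (Sum.elim (fun _ => Pi.single 0 1 + Pi.single 2 1)
        (fun _ => Pi.single 1 1 + Pi.single 2 1))) :
    coeff (Finsupp.equivFunOnFinite.symm fun l : Fin 3 =>
        ((univ : Finset ((Unit ⊕ σ) ⊕ (Fin (m + 1) ⊕ Fin (m + 1)))).filter
          (fun t => blk t = l)).card - 1) (∏ j, ∑ l, δ j l • (X l : MvPolynomial (Fin 3) ℕ)) =
      conormalBezout (m + 1) (Fintype.card σ) := by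
  classical
  have hcardS : Fintype.card {i : σ // i ≠ j₀ ∧ i ≠ k₀} = Fintype.card σ - 2 := by
    rw [Fintype.card_subtype]
    have hset : (univ.filter fun i : σ => i ≠ j₀ ∧ i ≠ k₀) = (univ.erase j₀).erase k₀ := by
      ext i
      simp only [Finset.mem_filter, Finset.mem_univ, true_and, Finset.mem_erase, and_true]
      tauto
    rw [hset, Finset.card_erase_of_mem (Finset.mem_erase.mpr ⟨hjk.symm, Finset.mem_univ _⟩),
      Finset.card_erase_of_mem (Finset.mem_univ _), Finset.card_univ]
    omega
  have hc : ∀ l : Fin 3, ((univ : Finset ((Unit ⊕ σ) ⊕ (Fin (m + 1) ⊕ Fin (m + 1)))).filter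
      (fun t => blk t = l)).card = ![Fintype.card σ + 1, m + 1, m + 1] l := by
    intro l
    rw [Finset.card_filter, Fintype.sum_sum_type, Fintype.sum_sum_type, Fintype.sum_sum_type]
    fin_cases l
    · simp [hblk]; omega
    · simp [hblk]
    · simp [hblk]
  have hexp : (Finsupp.equivFunOnFinite.symm fun l : Fin 3 =>
      ((univ : Finset ((Unit ⊕ σ) ⊕ (Fin (m + 1) ⊕ Fin (m + 1)))).filter
        (fun t => blk t = l)).card - 1) =
      Finsupp.single 0 (Fintype.card σ) + Finsupp.single 1 (m + 1 - 1) +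
        Finsupp.single 2 (m + 1 - 1) := by
    ext l
    simp only [Finsupp.coe_equivFunOnFinite_symm, hc, Finsupp.add_apply,
      Finsupp.single_apply]
    fin_cases l <;> simp
  have hprod : (∏ j, ∑ l, δ j l • (X l : MvPolynomial (Fin 3) ℕ)) =
      X 0 * (X 0 + X 1) ^ (m + 1) * (X 0 + X 2) ^ (m + 1 - 1) *
        (X 1 + X 2) ^ (Fintype.card σ - 2) := by
    rw [Fintype.prod_sum_type, Fintype.prod_sum_type, Fintype.prod_sum_type]
    simp only [hδdef, Sum.elim_inl, Sum.elim_inr, Finset.prod_const, Finset.card_univ,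
      Fintype.card_fin, Fintype.card_unit, hcardS, Fin.sum_univ_three, Pi.add_apply,
      Pi.single_apply]
    simp
    ring
  rw [hexp, hprod, coeff_generatingFunction_eq_conormalBezout (m + 1) (Fintype.card σ) (by omega)
    (by omega)]

end Summit.ValiantsHypothesis.ValiantsHypothesis.Theorems.DetQPDetqpSuperquadratic

end
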